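import Summits.CriticalPhenomena.PercolationContinuityZ3.Theses.PercNearOneGluing

/-!
# Strategist h1 — typed statements behind STRATEGY-CENSUS h1 (published as Cruxes/NearOneGluing/SketchH1Strategist.lean) (crux stmt-CriticalPhenomena-4574)

Every `def … : Prop` below is a STATEMENT recorded by the census (no claim of truth unless a
`theorem` proves it here).  The theorems are the elementary joins/implications the census cites:

* `WHalf`, `BoostHalf`, `nearOneGluing_of_floor_boost`, `wHalf_of_nearOneGluing`,
  `boostHalf_of_nearOneGluing` — census D11 (floor-and-boost split; join = modus ponens).
* `VisibleRelaysGluing`, `visibleRelays_of_nearOneGluing`, `VisibleLifting` — census S13.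
* `FootprintFloor` — census S14 / R14 (provable now from BHK Thm 1.3 = tree `stub_bhkClusterAssociation`).
* `SourceConditionedRescue` — census R12 (provable now from
  `Literature.Probability.Percolation.BHK2006_twoClusterConditionalAssociation_holds`).
* `RelayCountGluing`, `HarmonicGluing` — the kernel of the registered line `relay_count_gluing` and its
  provable harmonic calibration (census S15).
-/

namespace Summit.CriticalPhenomena.PercolationContinuityZ3.Cruxes.NearOneGluing.StrategistH1

open MeasureTheory
open scoped Classical
open Literature.Probability.LatticeModels Literature.Probability.Percolation
open Summit.CriticalPhenomena.PercolationContinuityZ3.Theses.PercNearOneGluing (NearOneGluing)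

/-! ## D11 — floor-and-boost -/

/-- Census D11, piece 1 ("W at the fixed floor 1/2"): SOME δ > 0 makes every level-δ instance
half-glued.  Strictly weaker than the crux in form (`wHalf_of_nearOneGluing`); open. -/
def WHalf : Prop :=
  ∃ δ : ℝ, 0 < δ ∧ ∀ (n : ℕ) (w : Sym2 (Fin n) → unitInterval) (A : Finset (Fin n)) (o b : Fin n),
    1 - δ < (prodBernoulli w).real (⋃ a ∈ A, openConn o a) →
    (∀ a ∈ A, 1 - δ < (prodBernoulli w).real (openConn a b)) →
    (1 / 2 : ℝ) ≤ (prodBernoulli w).real (openConn o b)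

/-- Census D11, piece 2 ("boost from the floor 1/2"): the crux restricted to instances that are
already half-glued.  Strictly weaker than the crux in form (`boostHalf_of_nearOneGluing`); open;
modulo `WHalf` it is every instance (why the split is not filed). -/
def BoostHalf : Prop :=
  ∀ ε : ℝ, 0 < ε → ∃ δ : ℝ, 0 < δ ∧ ∀ (n : ℕ) (w : Sym2 (Fin n) → unitInterval) (A : Finset (Fin n))
    (o b : Fin n),
    1 - δ < (prodBernoulli w).real (⋃ a ∈ A, openConn o a) →
    (∀ a ∈ A, 1 - δ < (prodBernoulli w).real (openConn a b)) →
    (1 / 2 : ℝ) ≤ (prodBernoulli w).real (openConn o b) →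
    1 - ε < (prodBernoulli w).real (openConn o b)

/-- The join of D11 (modus ponens with `δ = min δ_W δ_B`). -/
theorem nearOneGluing_of_floor_boost (hW : WHalf) (hB : BoostHalf) : NearOneGluing := by
  intro ε hε
  obtain ⟨δ₁, hδ₁, h₁⟩ := hW
  obtain ⟨δ₂, hδ₂, h₂⟩ := hB ε hε
  refine ⟨min δ₁ δ₂, lt_min hδ₁ hδ₂, ?_⟩
  intro n w A o b hoA hab
  have hm₁ : min δ₁ δ₂ ≤ δ₁ := min_le_left _ _
  have hm₂ : min δ₁ δ₂ ≤ δ₂ := min_le_right _ _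
  have hoA₁ : 1 - δ₁ < (prodBernoulli w).real (⋃ a ∈ A, openConn o a) := by linarith
  have hoA₂ : 1 - δ₂ < (prodBernoulli w).real (⋃ a ∈ A, openConn o a) := by linarith
  have hab₁ : ∀ a ∈ A, 1 - δ₁ < (prodBernoulli w).real (openConn a b) :=
    fun a ha => by have := hab a ha; linarith
  have hab₂ : ∀ a ∈ A, 1 - δ₂ < (prodBernoulli w).real (openConn a b) :=
    fun a ha => by have := hab a ha; linarith
  exact h₂ n w A o b hoA₂ hab₂ (h₁ n w A o b hoA₁ hab₁)

theorem wHalf_of_nearOneGluing (h : NearOneGluing) : WHalf := by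
  obtain ⟨δ, hδ, hh⟩ := h (1 / 2) (by norm_num)
  refine ⟨δ, hδ, fun n w A o b hoA hab => ?_⟩
  have := hh n w A o b hoA hab
  linarith

theorem boostHalf_of_nearOneGluing (h : NearOneGluing) : BoostHalf := by
  intro ε hε
  obtain ⟨δ, hδ, hh⟩ := h ε hε
  exact ⟨δ, hδ, fun n w A o b hoA hab _ => hh n w A o b hoA hab⟩

/-! ## S13 — visible relays -/

/-- Census S13 (`S⁺` with uniformly visible relays): the crux under the EXTRA hypothesis that every
relay is reached from `o` with probability at least `c`.  Formally weaker than the crux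
(`visibleRelays_of_nearOneGluing`); in fact equivalent (`VisibleLifting`): a counterexample to the
crux becomes one to this statement after adding one `o–b` pair of weight `c`
(`u ↦ (1 - c) u`, both hypotheses preserved, `q_a ≥ c (1 - δ)` by Harris). -/
def VisibleRelaysGluing : Prop :=
  ∀ c : ℝ, 0 < c → ∀ ε : ℝ, 0 < ε → ∃ δ : ℝ, 0 < δ ∧ ∀ (n : ℕ) (w : Sym2 (Fin n) → unitInterval)
    (A : Finset (Fin n)) (o b : Fin n),
    1 - δ < (prodBernoulli w).real (⋃ a ∈ A, openConn o a) →
    (∀ a ∈ A, 1 - δ < (prodBernoulli w).real (openConn a b)) →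
    (∀ a ∈ A, c ≤ (prodBernoulli w).real (openConn o a)) →
    1 - ε < (prodBernoulli w).real (openConn o b)

theorem visibleRelays_of_nearOneGluing (h : NearOneGluing) : VisibleRelaysGluing := by
  intro c _ ε hε
  obtain ⟨δ, hδ, hh⟩ := h ε hε
  exact ⟨δ, hδ, fun n w A o b hoA hab _ => hh n w A o b hoA hab⟩

/-- Census S13, the lifting direction (NOT proved here; size M: monotonicity of `prodBernoulli` in
one weight + the one-bond factorisation `μ_{w[ob ↦ c']}(o ↮ b) = (1 - c') · μ_{w[ob ↦ 0]}(o ↮ b)`,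
cf. `Theorems/PercNearOneGluingAdditiveGluingGoodStepOneBond.lean`). -/
def VisibleLifting : Prop := VisibleRelaysGluing → NearOneGluing

/-! ## S14 / R14 — the footprint floor (conditioned association) -/

/-- Census S14/R14 ("FootprintFloor", provable now from BHK 2006 Thm 1.3 = the landed
`Theorems.stub_bhkClusterAssociation`): conditioned on `{o ↮ a₀}` the events `{o ↮ a}` are
positively associated, hence `P(o ↮ A | o ↮ a₀) ≥ ∏_{a} P(o ↮ a | o ↮ a₀)`; written
denominator-free with `C := {o ↮ a₀}`:
`P(C)^{|A|-1} · P(C ∩ {o ↮ A}) ≥ ∏_{a ∈ A} (P(C) - P(C ∩ {o ↔ a}))` (the factor for `a = a₀ ∈ A`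
is `P(C)` itself).  Consequence (census S14): under the crux hypotheses with `b := a₀`,
`E[N ; o ↮ a₀] ≥ u · ln(u/δ) · (1 - o(1))`, `u = P(o ↮ a₀)` — a lower bound on the footprint of
the bad event, dominated by the landed `multiCopyFootprint`. -/
def FootprintFloor : Prop :=
  ∀ (n : ℕ) (w : Sym2 (Fin n) → unitInterval) (A : Finset (Fin n)) (o a₀ : Fin n), a₀ ∈ A →
    (∏ a ∈ A, ((prodBernoulli w).real (openConn o a₀)ᶜ -
        (prodBernoulli w).real ((openConn o a₀)ᶜ ∩ openConn o a))) ≤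
      (prodBernoulli w).real (openConn o a₀)ᶜ ^ (A.card - 1) *
        (prodBernoulli w).real ((openConn o a₀)ᶜ ∩ (⋃ a ∈ A, openConn o a)ᶜ)

/-! ## R12 — source-conditioned rescue bounds -/

/-- Census R12 ("SourceConditionedRescue", provable now from
`BHK2006_twoClusterConditionalAssociation_holds` with `s = o`, `t = b`, `F = 1{z attached}`
(increasing in `C_o`), `G = 1{y ↮ b}` (decreasing in `C_b`)): on the bad world `{o ↮ b}` the
attachment of `z` and the survival of `y` are NEGATIVELY correlated,
`P(Zt, y ↔ b, o ↮ b) · P(o ↮ b) ≤ P(Zt, o ↮ b) · P(y ↔ b, o ↮ b)`;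
since `Zt ∩ {z ↮ b} = Zt ∩ {o ↮ b}`, the left side is `P(o ↮ b) · μ(Zt ∩ f₁)` of the lead's
`stub_attachRescueNegCorr` — a parallel (source-conditioned) family of rescue bounds, incomparable
with the landed relay-conditioned one (ratio = `[μ(Zt | o↮b)/μ(Zt)] · [μ(y↔b | o↮b)/μ(y↔b, z↮b)·μ(f₁)…]`,
see census).  The lead's lp2 already contains "BHK owner-o product bounds", so this is recorded,
not offered as new leverage. -/
def SourceConditionedRescue : Prop :=
  ∀ (n : ℕ) (w : Sym2 (Fin n) → unitInterval) (S : Set (Fin n)) (o b y z : Fin n), o ≠ b →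
    (prodBernoulli w).real (openConnIn S o z ∩ (openConn y b ∩ (openConn o b)ᶜ)) *
        (prodBernoulli w).real (openConn o b)ᶜ ≤
      (prodBernoulli w).real (openConnIn S o z ∩ (openConn o b)ᶜ) *
        (prodBernoulli w).real (openConn y b ∩ (openConn o b)ᶜ)


/-! ## Line relay_count_gluing — the kernel and its harmonic calibration (census S15 / line card) -/

/-- The kernel of the registered line `Lines/relay_count_gluing.lean` (= its `stub_relayCountGluing`):
Kozma–Nitzan Conjecture 4 in post-FKG form at the cluster property `f = |C ∩ A|`, min-free. -/
def RelayCountGluing : Prop :=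
  ∀ (n : ℕ) (w : Sym2 (Fin n) → unitInterval) (A : Finset (Fin n)) (o : Fin n) (t : ℝ),
    (∀ a ∈ A, t ≤ ∑ α ∈ A, (prodBernoulli w).real (openConn a α)) →
    (prodBernoulli w).real (⋃ a ∈ A, openConn o a) * t ≤ ∑ a ∈ A, (prodBernoulli w).real (openConn o a)

/-- **HarmonicGluing** (census S15; PROVABLE NOW — union bound over the clusters of `G − o` hit by `o`
+ Harris on `G − o` for "hitting probability (↑) × inverse footprint (↓)"; recommended `--supports`
deliverable for the line): for `o ∉ A`,
`P(o ↔ A) ≤ Σ_{a∈A} P(o ↔ a) · E[ 1 / |C_{G−o}(a) ∩ A| ]`, the cluster of `a` in `G − o` being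
`{α | openConnIn {v | v ≠ o} a α}` (it contains `a`, so the denominator is ≥ 1).  Equivalently
`E N ≥ P(o↔A) · min_a (E[1/|C_{G−o}(a)∩A|])⁻¹`: the HARMONIC-mean version of `RelayCountGluing`. -/
def HarmonicGluing : Prop :=
  ∀ (n : ℕ) (w : Sym2 (Fin n) → unitInterval) (A : Finset (Fin n)) (o : Fin n), o ∉ A →
    (prodBernoulli w).real (⋃ a ∈ A, openConn o a) ≤
      ∑ a ∈ A, (prodBernoulli w).real (openConn o a) *
        ∫ ω, ((A.filter fun α => ω ∈ openConnIn {v : Fin n | v ≠ o} a α).card : ℝ)⁻¹ ∂(prodBernoulli w)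

end Summit.CriticalPhenomena.PercolationContinuityZ3.Cruxes.NearOneGluing.StrategistH1
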